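import Summits.HodgeConjecture.CorCM.IrreducibleOddWeightsHelly
import HarnessLib

/-!
# Additivity of the rank (`Hg(∏ A_i) = ∏ Hg(A_i)`, degenerate members allowed): the finite criterion and its Helly number

COR-CM (cell `pub-hodgecm2`, binder seat `b16` gen 59, count-neutral claim INDEX BOUND, file F7 — abstract `G`-set level;
theorems only, no definition, no named fact, no `sorry`).  NEW as stated, hence under `Summits/`.  HONEST FRAMING:
unconditional finite-dimensional linear algebra over `ℚ` about the rank of families of CM types, read on Mumford–Tate
groups of products of CM abelian varieties; `HC_CM` is neither used nor asserted.

ADDITIVITY.  For a family of CM types `Φ_i ⊆ E_i` with family type `Σ`, always `dim U(Σ) ≤ Σ_i dim U(Φ_i)`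
(`rank(Σ) − 1 ≤ Σ_i (rank(Φ_i) − 1)`; on Mumford–Tate groups `Hg(∏_i A_i) ⊆ ∏_i Hg(A_i)`, tree
`typeRank_sigmaType_add_card_le`, `CMAlgebra.cmFamilyRank_add_card_le_sum`).  The family is ADDITIVE when equality holds:
`Hg(∏_i A_i) = ∏_i Hg(A_i)` — with NO nondegeneracy asked of the members (degenerate CM types, e.g. of Weil type, are
allowed; «nondegenerate family» = additive + all members nondegenerate, tree
`CMTorus.isNondegenerateFamily_iff_mtRank_sigmaPiPeriod_add_card_eq_and_forall`).  The gen-57/58 finite criteria and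
Helly number were stated for NONDEGENERATE families; this file runs them for ADDITIVITY:

* §1 **`finrank_antiSpan_sigmaType_eq_sum_iff_forall`** — for pairwise non-isomorphic irreducibles `(π_k, V_k)` covering
  the members: `dim U(Σ) = Σ_i dim U(Φ_i)` IFF for every `k` the slot evaluation spaces `Ev_i(π_k) ≤ V_k` are independent
  (`dim Σ_i Ev_i(π_k) = Σ_i dim Ev_i(π_k)`); rank form `typeRank_sigmaType_add_card_eq_iff_forall`.
* §2 **`finrank_antiSpan_sigmaType_eq_sum_iff_forall_card_le`** — THE HELLY NUMBER OF ADDITIVITY: if `d_k ≤ q · δ_k` for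
  all `k`, the family is additive IFF every sub-family of at most `q + 1` members is (a minimal dependent set of
  evaluation spaces in `V_k` has `(|T| − 1) δ_k ≤ d_k`); `exists_card_le_finrank_antiSpan_sigmaType_ne_sum`.
* §3 **`card_le_finrank_antiSpan_succ_of_minimal_nonadditive`** — a MINIMAL non-additive family `T₀` (non-additive, all
  proper sub-families additive) has `|T₀| ≤ dim U(Φ_i) + 1 = rank(Φ_i)` for EVERY member `i` (the culprit irreducible
  `V_k` has `|T₀| − 1 ≤ d_k` and is a quotient of each `U(Φ_i)`, `i ∈ T₀`).

The sequel F8 `…AdditivityHelly` removes the covering list (F2 `…CoveringFamily`: it always exists) and reads `q` off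
the degrees (`q = max_i dim U(Φ_i) ≤ max_i |E_i|/2`) or off an abelian subgroup of finite index (F1 `…IndexBound`); F9
`…AdditivityHellyCMFields` is the CM-field dress: `Hg(∏_i A_i) = ∏_i Hg(A_i)` iff so on all sub-products of at most
`max_i dim Hg(A_i) + 1` factors.

## References

* [Mai1989] L. Mai, *Lower bounds for the ranks of CM types*, J. Number Theory 32 (1989), §2 Prop. 1 (proof).
* [Gordon1999HodgeAVSurvey] B. B. Gordon, *A survey of the Hodge conjecture for abelian varieties*, §3 Theorem (proof),
  7.5–7.7.
* [MoonenZarhin1999LowDim] B. Moonen, Yu. Zarhin, *Hodge classes on abelian varieties of low dimension*, Math. Ann.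
  315 (1999), §3 (3.1) (`Hg(X₁ × X₂) ⊆ Hg(X₁) × Hg(X₂)` with surjective projections).
* [Serre1977] J.-P. Serre, *Linear Representations of Finite Groups*, GTM 42 (1977), §2.2 Prop. 4.
-/

set_option autoImplicit false

noncomputable section

open scoped BigOperators

universe u u' v w

namespace Summit.HodgeConjecture.CorCM.IrrOdd

open Literature.NumberTheory.ComplexMultiplication

variable {G : Type w} [Group G]

/-- The evaluation space `Ev[G, π, w] = {T w : T equivariant}` (local notation, no definition). -/
local notation3 (prettyPrint := false) "Ev[" G' ", " π ", " w "]" =>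
  Submodule.span ℚ {v | ∃ T : (_ → ℚ) →ₗ[ℚ] _,
    (∀ (g : G') (f : _ → ℚ), T (fun x => f (g⁻¹ • x)) = π g (T f)) ∧ T w = v}

variable {I : Type u} {E : I → Type v} [∀ i, MulAction G (E i)] [Fintype I] [∀ i, Fintype (E i)]
  {K : Type u'} [Fintype K] {V : K → Type*} [∀ k, AddCommGroup (V k)] [∀ k, Module ℚ (V k)]
  [∀ k, FiniteDimensional ℚ (V k)]

/-! ### §1 Additivity ⟺ independent slot evaluation spaces in every covering irreducible -/

/-- **ADDITIVITY IS A FINITE TEST.**  For pairwise non-isomorphic irreducible `(π_k, V_k)` covering every member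
`U(Φ_i)` of a family of types `Φ_i ⊆ E_i` (no CM hypothesis needed): `dim U(Σ) = Σ_i dim U(Φ_i)` — on Mumford–Tate groups
`Hg(∏_i A_i) = ∏_i Hg(A_i)`, the members being ARBITRARY — IFF `dim Σ_i Ev_i(π_k) = Σ_i dim Ev_i(π_k)` for every `k`
(`dim U(Σ) = Σ_k d_k dim(Σ_i Ev_i)/δ_k ≤ Σ_k d_k (Σ_i dim Ev_i)/δ_k = Σ_i dim U(Φ_i)`, equality iff termwise).
[cite: Mai1989, §2 Prop. 1 (proof)] [cite: MoonenZarhin1999LowDim, §3 (3.1)] [cite: Gordon1999HodgeAVSurvey, §3 and 7.7] -/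
theorem finrank_antiSpan_sigmaType_eq_sum_iff_forall (Φ : ∀ i, Set (E i)) (π : ∀ k, Representation ℚ G (V k))
    (hirr : ∀ k, (π k).IsIrreducible) (hne : ∀ k l, k ≠ l → ∀ S : (π k).IntertwiningMap (π l), S = 0)
    (hcov : ∀ (i : I) (P : Submodule ℚ (E i → ℚ)), P ≤ antiSpan G (Φ i) → P ≠ ⊥ →
      (∀ (g : G) (a : E i → ℚ), a ∈ P → (fun s => a (g • s)) ∈ P) →
      ∃ k, ∃ T : (E i → ℚ) →ₗ[ℚ] V k,
        (∀ (g : G) (a : E i → ℚ), T (fun s => a (g⁻¹ • s)) = π k g (T a)) ∧ ∃ a ∈ P, T a ≠ 0) :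
    Module.finrank ℚ (antiSpan G (sigmaType Φ)) = ∑ i, Module.finrank ℚ (antiSpan G (Φ i)) ↔
      ∀ k, Module.finrank ℚ (⨆ i, Ev[G, π k, antiVec (Φ i) (1 : G)] : Submodule ℚ (V k)) =
        ∑ i, Module.finrank ℚ Ev[G, π k, antiVec (Φ i) (1 : G)] := by
  classical
  obtain ⟨hdS, hS⟩ := finrank_antiSpan_sigmaType_eq_sum Φ π hirr hne (cover_sigmaType_of_forall Φ π hcov)
  have hmem : ∀ i, (∀ k, Module.finrank ℚ ((π k).IntertwiningMap (π k)) ∣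
      Module.finrank ℚ Ev[G, π k, antiVec (Φ i) (1 : G)]) ∧
      Module.finrank ℚ (antiSpan G (Φ i)) = ∑ k, Module.finrank ℚ (V k) *
        (Module.finrank ℚ Ev[G, π k, antiVec (Φ i) (1 : G)] / Module.finrank ℚ ((π k).IntertwiningMap (π k))) :=
    fun i => finrank_antiSpan_eq_sum (Φ i) π hirr hne (hcov i)
  have hle1 : ∀ k, Module.finrank ℚ (⨆ i, Ev[G, π k, antiVec (Φ i) (1 : G)] : Submodule ℚ (V k)) ≤
      ∑ i, Module.finrank ℚ Ev[G, π k, antiVec (Φ i) (1 : G)] := fun k =>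
    finrank_iSup_le_sum_finrank _
  have hsum : ∑ i, Module.finrank ℚ (antiSpan G (Φ i)) = ∑ k, Module.finrank ℚ (V k) *
      ((∑ i, Module.finrank ℚ Ev[G, π k, antiVec (Φ i) (1 : G)]) / Module.finrank ℚ ((π k).IntertwiningMap (π k))) := by
    rw [Finset.sum_congr rfl fun i _ => (hmem i).2, Finset.sum_comm]
    refine Finset.sum_congr rfl fun k _ => ?_
    rw [← Finset.mul_sum, ← Nat.sum_div fun i _ => (hmem i).1 k]
  have hdvd2 : ∀ k, Module.finrank ℚ ((π k).IntertwiningMap (π k)) ∣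
      ∑ i, Module.finrank ℚ Ev[G, π k, antiVec (Φ i) (1 : G)] := fun k =>
    Finset.dvd_sum fun i _ => (hmem i).1 k
  constructor
  · intro heq
    rw [hS, hsum] at heq
    exact forall_eq_of_sum_mul_div_eq (fun k => finrank_pos_of_isIrreducible (π k) (hirr k)) hdS hdvd2 hle1 heq
  · intro hind
    rw [hS, hsum]
    exact Finset.sum_congr rfl fun k _ => by rw [hind k]

/-- **Rank form**: `rank(Σ) + |I| = Σ_i rank(Φ_i) + 1` (`dim MT(∏_i A_i) − 1 = Σ_i (dim MT(A_i) − 1)`, i.e.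
`Hg(∏_i A_i) = ∏_i Hg(A_i)`) IFF the slot evaluation spaces are independent in every covering irreducible.
[cite: Mai1989, §2 Prop. 1 (proof)] [cite: MoonenZarhin1999LowDim, §3 (3.1)] [cite: Gordon1999HodgeAVSurvey, 7.7] -/
theorem typeRank_sigmaType_add_card_eq_iff_forall [Nonempty I] [∀ i, Nonempty (E i)] {ρ : G}
    {Φ : ∀ i, Set (E i)} (h : ∀ i, IsCMTypeWith ρ (Φ i)) (π : ∀ k, Representation ℚ G (V k))
    (hirr : ∀ k, (π k).IsIrreducible) (hne : ∀ k l, k ≠ l → ∀ S : (π k).IntertwiningMap (π l), S = 0)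
    (hcov : ∀ (i : I) (P : Submodule ℚ (E i → ℚ)), P ≤ antiSpan G (Φ i) → P ≠ ⊥ →
      (∀ (g : G) (a : E i → ℚ), a ∈ P → (fun s => a (g • s)) ∈ P) →
      ∃ k, ∃ T : (E i → ℚ) →ₗ[ℚ] V k,
        (∀ (g : G) (a : E i → ℚ), T (fun s => a (g⁻¹ • s)) = π k g (T a)) ∧ ∃ a ∈ P, T a ≠ 0) :
    typeRank G (sigmaType Φ) + Fintype.card I = (∑ i, typeRank G (Φ i)) + 1 ↔
      ∀ k, Module.finrank ℚ (⨆ i, Ev[G, π k, antiVec (Φ i) (1 : G)] : Submodule ℚ (V k)) =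
        ∑ i, Module.finrank ℚ Ev[G, π k, antiVec (Φ i) (1 : G)] := by
  obtain ⟨i₀⟩ := ‹Nonempty I›
  haveI : Nonempty (Σ i, E i) := ⟨⟨i₀, Classical.arbitrary (E i₀)⟩⟩
  rw [← finrank_antiSpan_sigmaType_eq_sum_iff_forall Φ π hirr hne hcov,
    (IsCMTypeWith.sigmaType h).typeRank_eq_finrank_antiSpan_add_one,
    Finset.sum_congr rfl fun i _ => (h i).typeRank_eq_finrank_antiSpan_add_one, Finset.sum_add_distrib,
    Finset.sum_const, Finset.card_univ, smul_eq_mul, mul_one]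
  omega

/-! ### §2 The Helly number of additivity -/

/-- **THE HELLY NUMBER OF ADDITIVITY.**  Pairwise non-isomorphic irreducibles `(π_k, V_k)` covering the members and `q`
with `d_k ≤ q · δ_k` for all `k`: `dim U(Σ) = Σ_i dim U(Φ_i)` (`Hg(∏_i A_i) = ∏_i Hg(A_i)`, degenerate members allowed)
IFF every sub-family with AT MOST `q + 1` MEMBERS is additive.  (⟸: a minimal dependent set `T` of slot evaluation
spaces in `V_k` has all members non-zero, of dimension `≥ δ_k`, independent after removing one: `(|T| − 1) δ_k ≤ d_k`.)
[cite: Mai1989, §2 Prop. 1 (proof)] [cite: MoonenZarhin1999LowDim, §3 (3.1)] [cite: Gordon1999HodgeAVSurvey, 7.5–7.7] -/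
theorem finrank_antiSpan_sigmaType_eq_sum_iff_forall_card_le (Φ : ∀ i, Set (E i))
    (π : ∀ k, Representation ℚ G (V k)) (hirr : ∀ k, (π k).IsIrreducible)
    (hne : ∀ k l, k ≠ l → ∀ S : (π k).IntertwiningMap (π l), S = 0)
    (hcov : ∀ (i : I) (P : Submodule ℚ (E i → ℚ)), P ≤ antiSpan G (Φ i) → P ≠ ⊥ →
      (∀ (g : G) (a : E i → ℚ), a ∈ P → (fun s => a (g • s)) ∈ P) →
      ∃ k, ∃ T : (E i → ℚ) →ₗ[ℚ] V k,
        (∀ (g : G) (a : E i → ℚ), T (fun s => a (g⁻¹ • s)) = π k g (T a)) ∧ ∃ a ∈ P, T a ≠ 0)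
    (q : ℕ) (hq : ∀ k, Module.finrank ℚ (V k) ≤ q * Module.finrank ℚ ((π k).IntertwiningMap (π k))) :
    Module.finrank ℚ (antiSpan G (sigmaType Φ)) = ∑ i, Module.finrank ℚ (antiSpan G (Φ i)) ↔
      ∀ T : Finset I, T.card ≤ q + 1 →
        Module.finrank ℚ (antiSpan G (sigmaType fun j : (T : Set I) => Φ j)) =
          ∑ j : (T : Set I), Module.finrank ℚ (antiSpan G (Φ j)) := by
  classical
  -- §1 for the family and for every sub-family
  have hF := finrank_antiSpan_sigmaType_eq_sum_iff_forall Φ π hirr hne hcov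
  have hFT : ∀ T : Finset I,
      (Module.finrank ℚ (antiSpan G (sigmaType fun j : (T : Set I) => Φ j)) =
          ∑ j : (T : Set I), Module.finrank ℚ (antiSpan G (Φ j)) ↔
        ∀ k, Module.finrank ℚ (⨆ j : (T : Set I), Ev[G, π k, antiVec (Φ j) (1 : G)] : Submodule ℚ (V k)) =
          ∑ j : (T : Set I), Module.finrank ℚ Ev[G, π k, antiVec (Φ j) (1 : G)]) := fun T =>
    finrank_antiSpan_sigmaType_eq_sum_iff_forall (E := fun j : (T : Set I) => E j) (fun j => Φ j) π hirr hne
      fun j => hcov j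
  -- the slot evaluation spaces
  set S : ∀ k, I → Submodule ℚ (V k) := fun k i => Ev[G, π k, antiVec (Φ i) (1 : G)] with hS
  have hδpos : ∀ k, 0 < Module.finrank ℚ ((π k).IntertwiningMap (π k)) := fun k =>
    finrank_intertwiningMap_pos (π k) (hirr k)
  have hdvd : ∀ k i, Module.finrank ℚ ((π k).IntertwiningMap (π k)) ∣ Module.finrank ℚ (S k i) := fun k i =>
    (finrank_antiSpan_eq_sum (Φ i) π hirr hne (hcov i)).1 k
  have hsupT : ∀ (k) (T : Finset I), (⨆ j : (T : Set I), S k j : Submodule ℚ (V k)) = T.sup (S k) := fun k T =>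
    (finsetSup_eq_iSup_subtype (S k) T).symm
  have hsumT : ∀ (k) (T : Finset I), ∑ j : (T : Set I), Module.finrank ℚ (S k j) =
      ∑ i ∈ T, Module.finrank ℚ (S k i) := fun k T => Finset.sum_coe_sort T fun i => Module.finrank ℚ (S k i)
  have hsupU : ∀ k, (⨆ i, S k i : Submodule ℚ (V k)) = Finset.univ.sup (S k) := fun k =>
    (Finset.sup_univ_eq_iSup (S k)).symm
  constructor
  · -- ⟹: independence passes to sub-families
    intro hadd T _
    have hind := hF.1 hadd
    refine (hFT T).2 fun k => ?_
    change Module.finrank ℚ (⨆ j : (T : Set I), S k j : Submodule ℚ (V k)) = ∑ j : (T : Set I), Module.finrank ℚ (S k j)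
    rw [hsupT, hsumT]
    refine finrank_finsetSup_eq_sum_of_subset (S k) (Finset.subset_univ T) ?_
    rw [← hsupU]
    exact hind k
  · -- ⟸: a minimal dependent finset of slot evaluation spaces has at most `q + 1` elements
    intro hsub
    refine hF.2 fun k => ?_
    change Module.finrank ℚ (⨆ i, S k i : Submodule ℚ (V k)) = ∑ i, Module.finrank ℚ (S k i)
    rw [hsupU]
    by_contra hbad
    have hex : ∃ n, ∃ T : Finset I, T.card = n ∧
        Module.finrank ℚ (T.sup (S k) : Submodule ℚ (V k)) ≠ ∑ i ∈ T, Module.finrank ℚ (S k i) :=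
      ⟨_, Finset.univ, rfl, hbad⟩
    obtain ⟨T, hTn, hT⟩ := Nat.find_spec hex
    have hmin : ∀ T' : Finset I, T'.card < T.card →
        Module.finrank ℚ (T'.sup (S k) : Submodule ℚ (V k)) = ∑ i ∈ T', Module.finrank ℚ (S k i) := by
      intro T' hT'
      by_contra hT'bad
      exact Nat.find_min hex (hTn ▸ hT') ⟨T', rfl, hT'bad⟩
    have hTne : T.Nonempty := by
      rw [Finset.nonempty_iff_ne_empty]
      rintro rfl
      exact hT (by rw [Finset.sup_empty, Finset.sum_empty, finrank_bot])
    have hne0 : ∀ i ∈ T, S k i ≠ ⊥ := by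
      intro i hi h0
      have h' := hmin (T.erase i) (Finset.card_erase_lt_of_mem hi)
      apply hT
      rw [← Finset.insert_erase hi, Finset.sup_insert, Finset.sum_insert (Finset.notMem_erase i T), h0, bot_sup_eq,
        finrank_bot, zero_add, h']
    have hcard : T.card ≤ q + 1 := by
      obtain ⟨i₁, hi₁⟩ := hTne
      have h' := hmin (T.erase i₁) (Finset.card_erase_lt_of_mem hi₁)
      have hge : (T.erase i₁).card * Module.finrank ℚ ((π k).IntertwiningMap (π k)) ≤
          ∑ i ∈ T.erase i₁, Module.finrank ℚ (S k i) := by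
        rw [Finset.card_eq_sum_ones, Finset.sum_mul]
        refine Finset.sum_le_sum fun i hi => ?_
        rw [one_mul]
        exact Nat.le_of_dvd (Nat.pos_of_ne_zero fun h0 => hne0 i (Finset.mem_of_mem_erase hi)
          (Submodule.finrank_eq_zero.1 h0)) (hdvd k i)
      have hle : ∑ i ∈ T.erase i₁, Module.finrank ℚ (S k i) ≤ q * Module.finrank ℚ ((π k).IntertwiningMap (π k)) :=
        (h' ▸ Submodule.finrank_le _).trans (hq k)
      have hcard' : (T.erase i₁).card ≤ q := Nat.le_of_mul_le_mul_right (hge.trans hle) (hδpos k)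
      rw [Finset.card_erase_of_mem hi₁] at hcard'
      omega
    have hgood := (hFT T).1 (hsub T hcard) k
    change Module.finrank ℚ (⨆ j : (T : Set I), S k j : Submodule ℚ (V k)) = ∑ j : (T : Set I), Module.finrank ℚ (S k j)
      at hgood
    rw [hsupT, hsumT] at hgood
    exact hT hgood

/-- **A non-additive family contains a non-additive sub-family of at most `q + 1` members** (`d_k ≤ q δ_k` on the
covering irreducibles): `Hg(∏_i A_i) ≠ ∏_i Hg(A_i)` is witnessed on a product of at most `q + 1` of the factors.
[cite: Mai1989, §2 Prop. 1 (proof)] [cite: MoonenZarhin1999LowDim, §3 (3.1)] [cite: Gordon1999HodgeAVSurvey, 7.7] -/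
theorem exists_card_le_finrank_antiSpan_sigmaType_ne_sum (Φ : ∀ i, Set (E i))
    (π : ∀ k, Representation ℚ G (V k)) (hirr : ∀ k, (π k).IsIrreducible)
    (hne : ∀ k l, k ≠ l → ∀ S : (π k).IntertwiningMap (π l), S = 0)
    (hcov : ∀ (i : I) (P : Submodule ℚ (E i → ℚ)), P ≤ antiSpan G (Φ i) → P ≠ ⊥ →
      (∀ (g : G) (a : E i → ℚ), a ∈ P → (fun s => a (g • s)) ∈ P) →
      ∃ k, ∃ T : (E i → ℚ) →ₗ[ℚ] V k,
        (∀ (g : G) (a : E i → ℚ), T (fun s => a (g⁻¹ • s)) = π k g (T a)) ∧ ∃ a ∈ P, T a ≠ 0)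
    (q : ℕ) (hq : ∀ k, Module.finrank ℚ (V k) ≤ q * Module.finrank ℚ ((π k).IntertwiningMap (π k)))
    (hnot : Module.finrank ℚ (antiSpan G (sigmaType Φ)) ≠ ∑ i, Module.finrank ℚ (antiSpan G (Φ i))) :
    ∃ T : Finset I, T.card ≤ q + 1 ∧
      Module.finrank ℚ (antiSpan G (sigmaType fun j : (T : Set I) => Φ j)) ≠
        ∑ j : (T : Set I), Module.finrank ℚ (antiSpan G (Φ j)) := by
  by_contra hall
  push Not at hall
  exact hnot ((finrank_antiSpan_sigmaType_eq_sum_iff_forall_card_le Φ π hirr hne hcov q hq).2 fun T hTc => hall T hTc)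

/-! ### §3 Minimal non-additive families: `|T₀| ≤ rank(Φ_i)` for every member -/

omit [Fintype I] in
/-- **EVERY MEMBER OF A MINIMAL NON-ADDITIVE FAMILY HAS `rank(Φ_i) ≥ |T₀|`.**  Covering irreducibles given; `T₀` a
non-additive sub-family all of whose proper sub-families are additive.  THEN `|T₀| ≤ dim U(Φ_i) + 1` for every `i ∈ T₀`:
some `V_k` carries dependent slot evaluation spaces over `T₀`, all non-zero, any `|T₀| − 1` of them independent
(`|T₀| − 1 ≤ d_k`), and `V_k` is a quotient of each `U(Φ_i)` (`d_k ≤ dim U(Φ_i)`).  No CM hypothesis, degenerate members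
allowed. [cite: Mai1989, §2 Prop. 1 (proof)] [cite: Serre1977, §2.2 Prop. 4] [cite: MoonenZarhin1999LowDim, §3 (3.1)] -/
theorem card_le_finrank_antiSpan_succ_of_minimal_nonadditive (Φ : ∀ i, Set (E i))
    (π : ∀ k, Representation ℚ G (V k)) (hirr : ∀ k, (π k).IsIrreducible)
    (hne : ∀ k l, k ≠ l → ∀ S : (π k).IntertwiningMap (π l), S = 0)
    (hcov : ∀ (i : I) (P : Submodule ℚ (E i → ℚ)), P ≤ antiSpan G (Φ i) → P ≠ ⊥ →
      (∀ (g : G) (a : E i → ℚ), a ∈ P → (fun s => a (g • s)) ∈ P) →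
      ∃ k, ∃ T : (E i → ℚ) →ₗ[ℚ] V k,
        (∀ (g : G) (a : E i → ℚ), T (fun s => a (g⁻¹ • s)) = π k g (T a)) ∧ ∃ a ∈ P, T a ≠ 0)
    (T₀ : Finset I)
    (hnot : Module.finrank ℚ (antiSpan G (sigmaType fun j : (T₀ : Set I) => Φ j)) ≠
      ∑ j : (T₀ : Set I), Module.finrank ℚ (antiSpan G (Φ j)))
    (hmin : ∀ T : Finset I, T ⊂ T₀ →
      Module.finrank ℚ (antiSpan G (sigmaType fun j : (T : Set I) => Φ j)) =
        ∑ j : (T : Set I), Module.finrank ℚ (antiSpan G (Φ j)))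
    {i : I} (hi : i ∈ T₀) : T₀.card ≤ Module.finrank ℚ (antiSpan G (Φ i)) + 1 := by
  classical
  -- §1 for every sub-family
  have hFT : ∀ T : Finset I,
      (Module.finrank ℚ (antiSpan G (sigmaType fun j : (T : Set I) => Φ j)) =
          ∑ j : (T : Set I), Module.finrank ℚ (antiSpan G (Φ j)) ↔
        ∀ k, Module.finrank ℚ (⨆ j : (T : Set I), Ev[G, π k, antiVec (Φ j) (1 : G)] : Submodule ℚ (V k)) =
          ∑ j : (T : Set I), Module.finrank ℚ Ev[G, π k, antiVec (Φ j) (1 : G)]) := fun T =>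
    finrank_antiSpan_sigmaType_eq_sum_iff_forall (E := fun j : (T : Set I) => E j) (fun j => Φ j) π hirr hne
      fun j => hcov j
  set S : ∀ k, I → Submodule ℚ (V k) := fun k i => Ev[G, π k, antiVec (Φ i) (1 : G)] with hS
  have hsupT : ∀ (k) (T : Finset I), (⨆ j : (T : Set I), S k j : Submodule ℚ (V k)) = T.sup (S k) := fun k T =>
    (finsetSup_eq_iSup_subtype (S k) T).symm
  have hsumT : ∀ (k) (T : Finset I), ∑ j : (T : Set I), Module.finrank ℚ (S k j) =
      ∑ i ∈ T, Module.finrank ℚ (S k i) := fun k T => Finset.sum_coe_sort T fun i => Module.finrank ℚ (S k i)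
  have hind : ∀ T : Finset I, T ⊂ T₀ → ∀ k,
      Module.finrank ℚ (T.sup (S k) : Submodule ℚ (V k)) = ∑ i ∈ T, Module.finrank ℚ (S k i) := by
    intro T hT k
    have h1 := (hFT T).1 (hmin T hT) k
    change Module.finrank ℚ (⨆ j : (T : Set I), S k j : Submodule ℚ (V k)) = ∑ j : (T : Set I), Module.finrank ℚ (S k j)
      at h1
    rwa [hsupT, hsumT] at h1
  -- some `V_k` carries dependent slot evaluation spaces over `T₀`
  obtain ⟨k, hk⟩ : ∃ k, Module.finrank ℚ (T₀.sup (S k) : Submodule ℚ (V k)) ≠ ∑ i ∈ T₀, Module.finrank ℚ (S k i) := by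
    by_contra hall
    push Not at hall
    refine hnot ((hFT T₀).2 fun k => ?_)
    change Module.finrank ℚ (⨆ j : (T₀ : Set I), S k j : Submodule ℚ (V k)) = ∑ j : (T₀ : Set I), Module.finrank ℚ (S k j)
    rw [hsupT, hsumT]
    exact hall k
  -- every member of `T₀` has a non-zero evaluation space in `V_k`
  have hne0 : ∀ j ∈ T₀, S k j ≠ ⊥ := by
    intro j hj h0
    apply hk
    have h' := hind _ (Finset.erase_ssubset hj) k
    rw [← Finset.insert_erase hj, Finset.sup_insert, Finset.sum_insert (Finset.notMem_erase j T₀), h0, bot_sup_eq,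
      finrank_bot, zero_add, h']
  -- `|T₀| − 1 ≤ d_k`
  have hcardk : T₀.card - 1 ≤ Module.finrank ℚ (V k) := by
    have h' := hind _ (Finset.erase_ssubset hi) k
    have hge : (T₀.erase i).card ≤ ∑ j ∈ T₀.erase i, Module.finrank ℚ (S k j) := by
      rw [Finset.card_eq_sum_ones]
      refine Finset.sum_le_sum fun j hj => ?_
      exact Nat.pos_of_ne_zero fun h0 => hne0 j (Finset.mem_of_mem_erase hj) (Submodule.finrank_eq_zero.1 h0)
    have hle : ∑ j ∈ T₀.erase i, Module.finrank ℚ (S k j) ≤ Module.finrank ℚ (V k) := h' ▸ Submodule.finrank_le _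
    rw [Finset.card_erase_of_mem hi] at hge
    exact hge.trans hle
  -- `d_k ≤ dim U(Φ_i)`
  have hdk : Module.finrank ℚ (V k) ≤ Module.finrank ℚ (antiSpan G (Φ i)) := by
    obtain ⟨T, hT, hT0⟩ : ∃ T : (E i → ℚ) →ₗ[ℚ] V k,
        (∀ (g : G) (f : E i → ℚ), T (fun x => f (g⁻¹ • x)) = π k g (T f)) ∧ T (antiVec (Φ i) (1 : G)) ≠ 0 := by
      by_contra hall
      push Not at hall
      refine hne0 i hi (Submodule.span_eq_bot.2 ?_)
      rintro v ⟨T, hT, rfl⟩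
      exact hall T hT
    haveI := hirr k
    let W : Subrepresentation (π k) := ⟨(antiSpan G (Φ i)).map T, fun g w hw => by
      obtain ⟨b, hb, rfl⟩ := hw
      exact ⟨fun s => b (g⁻¹ • s), comp_smul_mem_antiSpan hb g⁻¹, hT g b⟩⟩
    rcases (hirr k).eq_bot_or_eq_top W with hW | hW
    · exfalso
      apply hT0
      have hmemW : T (antiVec (Φ i) (1 : G)) ∈ W.toSubmodule :=
        ⟨antiVec (Φ i) (1 : G), Submodule.subset_span ⟨1, rfl⟩, rfl⟩
      rw [hW] at hmemW
      exact (Submodule.mem_bot ℚ).1 hmemW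
    · have htop : (antiSpan G (Φ i)).map T = ⊤ := congrArg Subrepresentation.toSubmodule hW
      calc Module.finrank ℚ (V k) = Module.finrank ℚ (⊤ : Submodule ℚ (V k)) := (finrank_top ℚ (V k)).symm
        _ = Module.finrank ℚ ((antiSpan G (Φ i)).map T) := by rw [htop]
        _ ≤ Module.finrank ℚ (antiSpan G (Φ i)) := Submodule.finrank_map_le T _
  omega

end Summit.HodgeConjecture.CorCM.IrrOdd

end
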